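import Mathlib.NumberTheory.FrobeniusNumber
import Mathlib.GroupTheory.OrderOfElement
import Literature.NumberTheory.LFunctions.AutomaticSequenceComponents
import HarnessLib

/-!
# The period `d(A)` of the naturally induced transducer (Müllner 2017, Lemmas 2.8–2.9; proved)

Everything in this file is PROVED (plus plain definitions). It begins the structure theory §2.3 of
C. Müllner, *Automatic sequences fulfill the Sarnak conjecture* (Duke Math. J. 166 (2017)), for the
transducer `MinImage δ` of `AutomaticSequenceTransducer.lean`:

* `MinImage.IsIdLoop M w` — a path `w` from `M` to `M` with `T(M, w) = id` (Müllner's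
  "(eq:good_path)"); `MinImage.loopLengths k M = M_q = {|w| : w an identity loop at M over the
  DIGIT alphabet {0,…,k−1}}`, an additive submonoid of `ℕ` (`MinImage.loopMonoid`);
* **Lemma 2.8** (`MinImage.exists_isIdLoop_append`): every digit path extends to an identity loop
  by a digit word (`w ↦ w w' (w w')^{n-1}` with `n` the order of `T(M, w w')`);
* **Lemma 2.9**: `MinImage.period k M = gcd M_q` contains all large multiples of itself in `M_q`
  (`MinImage.exists_mem_loopLengths_of_ge`, Mathlib's `Nat.exists_mem_closure_of_ge`), is
  positive, and does NOT depend on the state (`MinImage.period_eq`); `transducerPeriod k δ = d(A)`.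

ALPHABET. The transducer files use words over all of `ℕ` for the images (harmless when the
letters `≥ k` act trivially, the tree's convention `digitRestrict`: identity letters do not change
images, ranks or outputs), but LENGTHS of loops must be taken over digit words only (a trivial
letter would be an identity loop of length `1`), so `loopLengths`, `period`, `transducerPeriod`
carry the base `k` and quantify over words with letters `< k`; the lemmas needing return paths
assume `∀ q d, k ≤ d → δ q d = q` (then every path has a digit path with the same action,
`wordAct_filter_of_trivial`). For `digitRestrict k δ` of a base-`k` automaton this is Müllner's
`d(A)` exactly.

Theorem 2.7 itself (the group `G`, `m₀`, and `T(q, Σ^{nd}) = G`) is not formalised here.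

## References
* C. Müllner, Duke Math. J. 166 (2017), §2.3, Lemmas 2.8, 2.9 (and the definition of `d(A)`).
  [Mullner2017]
-/

noncomputable section

open Finset

namespace Literature.NumberTheory.LFunctions

namespace MinImage

variable {σ : Type*} [Fintype σ] [DecidableEq σ] {δ : σ → ℕ → σ}

/-- The empty word fixes every transducer state. [folklore] -/
theorem next_nil (M : MinImage δ) : M.next [] = M :=
  Subtype.ext (by rw [coe_next, (funext fun _ => rfl : wordAct δ [] = id), image_id])

/-- An IDENTITY LOOP at `M`: a word leading from `M` back to `M` with trivial output
(Müllner's paths with "(eq:good_path)": `δ(q, w) = q`, `T(q, w) = id`). [cite: Mullner2017, §2.3] -/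
def IsIdLoop (M : MinImage δ) (w : List ℕ) : Prop :=
  M.next w = M ∧ M.T w = 1

/-- The empty word is an identity loop. [folklore] -/
theorem isIdLoop_nil (M : MinImage δ) : M.IsIdLoop [] :=
  ⟨M.next_nil, M.T_nil⟩

/-- Identity loops concatenate (Müllner, Remark before Lemma 2.8). [cite: Mullner2017, §2.3] -/
theorem IsIdLoop.append {M : MinImage δ} {v w : List ℕ} (hv : M.IsIdLoop v) (hw : M.IsIdLoop w) :
    M.IsIdLoop (v ++ w) := by
  refine ⟨by rw [next_append, hv.1, hw.1], ?_⟩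
  rw [T_append, hv.1, hv.2, hw.2]
  rfl

/-- Digit words are closed under concatenation. [folklore] -/
theorem digits_append {k : ℕ} {v w : List ℕ} (hv : ∀ d ∈ v, d < k) (hw : ∀ d ∈ w, d < k) :
    ∀ d ∈ v ++ w, d < k := fun d hd => by
  rcases List.mem_append.1 hd with h | h
  · exact hv d h
  · exact hw d h

/-- Filtering a word to its digits does not change the transducer transition when the letters
`≥ k` act trivially. [folklore] -/
theorem next_filter {k : ℕ} (htriv : ∀ q d, k ≤ d → δ q d = q) (M : MinImage δ) (u : List ℕ) :
    M.next (u.filter (· < k)) = M.next u :=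
  Subtype.ext (by
    simp only [coe_next]
    exact image_congr fun q _ => (wordAct_filter_of_trivial htriv u q).symm)

/-- Words with the same action have the same transducer transition. [folklore] -/
theorem next_congr_of_wordAct_eq (M : MinImage δ) {u v : List ℕ} (h : wordAct δ u = wordAct δ v) :
    M.next u = M.next v :=
  Subtype.ext (by simp only [coe_next, h])

/-- **Words with the same action have the same output** (so the transducer only sees the action
of a word; with letters `≥ k` trivial, a word and its subword of digits have the same output).
[folklore] -/
theorem T_congr_of_wordAct_eq (M : MinImage δ) {u v : List ℕ} (h : wordAct δ u = wordAct δ v) :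
    M.T u = M.T v := by
  ext i
  obtain ⟨x, rfl⟩ : ∃ x, M.enum x = i := M.enum.surjective i
  rw [T_apply_enum, T_apply_enum]
  have e1 : M.actEquiv u x = ⟨wordAct δ u x, (M.actEquiv u x).2⟩ := rfl
  have e2 : M.actEquiv v x = ⟨wordAct δ v x, (M.actEquiv v x).2⟩ := rfl
  have hmem : wordAct δ u x ∈ (M.next v).1 := by
    rw [h]; exact (M.actEquiv v x).2
  rw [e1, e2, enum_congr (M.next_congr_of_wordAct_eq h) (wordAct δ u x) (M.actEquiv u x).2 hmem]
  have hsub : (⟨wordAct δ u x, hmem⟩ : ↥(M.next v).1) = ⟨wordAct δ v x, (M.actEquiv v x).2⟩ :=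
    Subtype.ext (show wordAct δ u x = wordAct δ v x by rw [h])
  rw [hsub]

/-- Filtering a word to its digits does not change the output when the letters `≥ k` act
trivially. [folklore] -/
theorem T_filter {k : ℕ} (htriv : ∀ q d, k ≤ d → δ q d = q) (M : MinImage δ) (u : List ℕ) :
    M.T (u.filter (· < k)) = M.T u :=
  M.T_congr_of_wordAct_eq (funext fun q => (wordAct_filter_of_trivial htriv u q).symm)

/-- `M_q`: the lengths of the identity loops at `M` over the digit alphabet `{0, …, k-1}`.
[cite: Mullner2017, §2.3 (definition of M_q)] -/
def loopLengths (k : ℕ) (M : MinImage δ) : Set ℕ :=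
  {n | ∃ w : List ℕ, (∀ d ∈ w, d < k) ∧ w.length = n ∧ M.IsIdLoop w}

/-- `M_q` as an additive submonoid of `ℕ` ("`M_q` is closed under addition").
[cite: Mullner2017, Lemma 2.9 (proof)] -/
def loopMonoid (k : ℕ) (M : MinImage δ) : AddSubmonoid ℕ where
  carrier := M.loopLengths k
  zero_mem' := ⟨[], by simp, rfl, M.isIdLoop_nil⟩
  add_mem' := by
    rintro _ _ ⟨v, hvd, rfl, hv⟩ ⟨w, hwd, rfl, hw⟩
    exact ⟨v ++ w, digits_append hvd hwd, List.length_append, hv.append hw⟩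

/-- The carrier of `loopMonoid`. [folklore] -/
@[simp] theorem coe_loopMonoid (k : ℕ) (M : MinImage δ) :
    (M.loopMonoid k : Set ℕ) = M.loopLengths k := rfl

/-- Powers of a loop: reading `x` `j` times from `M` when `δ(M, x) = M`. [folklore] -/
theorem next_flatten_replicate {M : MinImage δ} {x : List ℕ} (hx : M.next x = M) (j : ℕ) :
    M.next (List.replicate j x).flatten = M := by
  induction j with
  | zero => exact M.next_nil
  | succ j ih => rw [List.replicate_succ, List.flatten_cons, next_append, hx, ih]

/-- The output along the `j`-th power of a loop is the `j`-th power of its output. [folklore] -/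
theorem T_flatten_replicate {M : MinImage δ} {x : List ℕ} (hx : M.next x = M) (j : ℕ) :
    M.T (List.replicate j x).flatten = M.T x ^ j := by
  induction j with
  | zero => rw [List.replicate_zero, List.flatten_nil, T_nil, pow_zero]
  | succ j ih =>
    rw [List.replicate_succ, List.flatten_cons, T_append, hx, ih, pow_succ]
    rfl

/-- Letters of a power of a digit word are digits. [folklore] -/
theorem digits_flatten_replicate {k : ℕ} {x : List ℕ} (hx : ∀ d ∈ x, d < k) (j : ℕ) :
    ∀ d ∈ (List.replicate j x).flatten, d < k := fun d hd => by
  rw [List.mem_flatten] at hd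
  obtain ⟨l, hl, hdl⟩ := hd
  rw [List.eq_of_mem_replicate hl] at hdl
  exact hx d hdl

/-- **Müllner 2017, Lemma 2.8 (inverse paths)**: for every state `M` and digit word `w` there is a
digit word `w̄` with `w w̄` an identity loop at `M` — take a digit word `w'` leading back to `M`
(strong connectivity of the transducer; letters `≥ k` act trivially) and `w̄ = w' (w w')^{n-1}` with
`n` the order of `T(M, w w')`. [cite: Mullner2017, Lemma 2.8] -/
theorem exists_isIdLoop_append {k : ℕ} (htriv : ∀ q d, k ≤ d → δ q d = q) (M : MinImage δ)
    {w : List ℕ} (hw : ∀ d ∈ w, d < k) :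
    ∃ wbar : List ℕ, (∀ d ∈ wbar, d < k) ∧ M.IsIdLoop (w ++ wbar) := by
  obtain ⟨u₀, hu₀⟩ := exists_image_eq (M.next w).2 M.2
  set u := u₀.filter (· < k) with hu_def
  have hud : ∀ d ∈ u, d < k := fun d hd => mem_filter_lt hd
  have hx : M.next (w ++ u) = M := by
    rw [next_append, hu_def, next_filter htriv]
    exact Subtype.ext hu₀
  set g := M.T (w ++ u) with hg
  set n := orderOf g with hn
  have hn0 : 0 < n := orderOf_pos g
  refine ⟨u ++ (List.replicate (n - 1) (w ++ u)).flatten,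
    digits_append hud (digits_flatten_replicate (digits_append hw hud) _), ?_⟩
  have heq : w ++ (u ++ (List.replicate (n - 1) (w ++ u)).flatten) =
      (List.replicate n (w ++ u)).flatten := by
    conv_rhs => rw [show n = n - 1 + 1 by omega, List.replicate_succ, List.flatten_cons]
    simp [List.append_assoc]
  rw [heq]
  exact ⟨next_flatten_replicate hx n, by rw [T_flatten_replicate hx n, ← hg, hn, pow_orderOf_eq_one]⟩

/-- `M_q` contains a positive length (`k ≥ 1`). [folklore] -/
theorem exists_pos_mem_loopLengths {k : ℕ} (hk : 0 < k) (htriv : ∀ q d, k ≤ d → δ q d = q)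
    (M : MinImage δ) : ∃ n ∈ M.loopLengths k, n ≠ 0 := by
  obtain ⟨wbar, hwd, h⟩ := M.exists_isIdLoop_append htriv (w := [0]) (by simpa using hk)
  exact ⟨_, ⟨_, digits_append (by simpa using hk) hwd, rfl, h⟩, by simp⟩

/-- The period of the transducer at `M`: `d_q = gcd M_q` (Müllner, Lemma 2.9), over the digit
alphabet `{0,…,k-1}`. [cite: Mullner2017, Lemma 2.9] -/
def period (k : ℕ) (M : MinImage δ) : ℕ :=
  Nat.setGcd (M.loopLengths k)

/-- `d_q` divides every identity-loop length. [cite: Mullner2017, Lemma 2.9] -/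
theorem period_dvd_of_mem {k : ℕ} {M : MinImage δ} {n : ℕ} (hn : n ∈ M.loopLengths k) :
    M.period k ∣ n :=
  Nat.setGcd_dvd_of_mem hn

/-- `d_q > 0`. [folklore] -/
theorem period_pos {k : ℕ} (hk : 0 < k) (htriv : ∀ q d, k ≤ d → δ q d = q) (M : MinImage δ) :
    0 < M.period k := by
  rw [pos_iff_ne_zero, period, Ne, Nat.setGcd_eq_zero_iff]
  intro h
  obtain ⟨n, hn, hn0⟩ := M.exists_pos_mem_loopLengths hk htriv
  exact hn0 (h hn)

/-- **Müllner 2017, Lemma 2.9, first part**: all sufficiently large multiples of `d_q` are lengths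
of identity loops at `M` (`d_q ℕ ∖ M_q` is finite; numerical-semigroup lemma, Mathlib's
`Nat.exists_mem_closure_of_ge`). [cite: Mullner2017, Lemma 2.9] -/
theorem exists_mem_loopLengths_of_ge (k : ℕ) (M : MinImage δ) :
    ∃ n₀ : ℕ, ∀ m, n₀ ≤ m → M.period k ∣ m → m ∈ M.loopLengths k := by
  obtain ⟨n₀, h⟩ := Nat.exists_mem_closure_of_ge (M.loopLengths k)
  refine ⟨n₀, fun m hm hd => ?_⟩
  have := h m hm hd
  rw [← coe_loopMonoid, AddSubmonoid.closure_eq] at this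
  exact this

/-- Transport of identity loops along a path and its inverse (proof of Lemma 2.9: the paths
`w w_i w̄^{q₂}`): if `δ(M₂, u) = M₁`, `u w̄` is an identity loop at `M₂` and `w₁` one at `M₁`, then
`u w₁ w̄` is an identity loop at `M₂`. [cite: Mullner2017, Lemma 2.9 (proof)] -/
theorem IsIdLoop.transport {M₁ M₂ : MinImage δ} {u wbar w₁ : List ℕ} (hu : M₂.next u = M₁)
    (hloop : M₂.IsIdLoop (u ++ wbar)) (h₁ : M₁.IsIdLoop w₁) : M₂.IsIdLoop (u ++ w₁ ++ wbar) := by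
  have hnext : M₁.next wbar = M₂ := by rw [← hu, ← next_append]; exact hloop.1
  have hT : (M₂.T u).trans (M₁.T wbar) = 1 := by rw [← hu, ← T_append]; exact hloop.2
  refine ⟨?_, ?_⟩
  · rw [next_append, next_append, hu, h₁.1, hnext]
  · rw [T_append, T_append, next_append, hu, h₁.1, h₁.2]
    rw [show (M₂.T u).trans (1 : Equiv.Perm (Fin (minRank δ))) = M₂.T u from Equiv.trans_refl _]
    exact hT

/-- **Müllner 2017, Lemma 2.9, second part**: `d_{q₂} ∣ d_{q₁}` for all states (transport two
identity loops at `M₁` of lengths `m` and `m + d_{q₁}`). [cite: Mullner2017, Lemma 2.9] -/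
theorem period_dvd_period {k : ℕ} (hk : 0 < k) (htriv : ∀ q d, k ≤ d → δ q d = q)
    (M₁ M₂ : MinImage δ) : M₂.period k ∣ M₁.period k := by
  obtain ⟨n₀, hn₀⟩ := M₁.exists_mem_loopLengths_of_ge k
  set d₁ := M₁.period k with hd₁
  have hm : n₀ * d₁ ∈ M₁.loopLengths k :=
    hn₀ _ (Nat.le_mul_of_pos_right _ (M₁.period_pos hk htriv)) (dvd_mul_left _ _)
  have hm' : n₀ * d₁ + d₁ ∈ M₁.loopLengths k :=
    hn₀ _ ((Nat.le_mul_of_pos_right _ (M₁.period_pos hk htriv)).trans (Nat.le_add_right _ _))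
      ((dvd_mul_left _ _).add dvd_rfl)
  obtain ⟨w₁, hw₁d, hw₁, hl₁⟩ := hm
  obtain ⟨w₂, hw₂d, hw₂, hl₂⟩ := hm'
  obtain ⟨u₀, hu₀⟩ := exists_image_eq M₂.2 M₁.2
  set u := u₀.filter (· < k) with hu_def
  have hud : ∀ d ∈ u, d < k := fun d hd => mem_filter_lt hd
  have hu' : M₂.next u = M₁ := by rw [hu_def, next_filter htriv]; exact Subtype.ext hu₀
  obtain ⟨wbar, hwbard, hloop⟩ := M₂.exists_isIdLoop_append htriv hud
  have ha : u.length + n₀ * d₁ + wbar.length ∈ M₂.loopLengths k :=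
    ⟨u ++ w₁ ++ wbar, digits_append (digits_append hud hw₁d) hwbard, by simp [hw₁]; ring,
      hloop.transport hu' hl₁⟩
  have hb : u.length + (n₀ * d₁ + d₁) + wbar.length ∈ M₂.loopLengths k :=
    ⟨u ++ w₂ ++ wbar, digits_append (digits_append hud hw₂d) hwbard, by simp [hw₂]; ring,
      hloop.transport hu' hl₂⟩
  have h := (Nat.dvd_sub (period_dvd_of_mem hb) (period_dvd_of_mem ha))
  rwa [show u.length + (n₀ * d₁ + d₁) + wbar.length - (u.length + n₀ * d₁ + wbar.length) = d₁ by omega]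
    at h

/-- **`d(A)` does not depend on the state** (Müllner, Lemma 2.9: "all `d_q` coincide").
[cite: Mullner2017, Lemma 2.9] -/
theorem period_eq {k : ℕ} (hk : 0 < k) (htriv : ∀ q d, k ≤ d → δ q d = q) (M₁ M₂ : MinImage δ) :
    M₁.period k = M₂.period k :=
  Nat.dvd_antisymm (period_dvd_period hk htriv M₂ M₁) (period_dvd_period hk htriv M₁ M₂)

end MinImage

section Period

variable {σ : Type*} [Fintype σ] [DecidableEq σ]

/-- A base point of the transducer (any minimal image). [folklore] -/
def transducerBase (δ : σ → ℕ → σ) : MinImage δ :=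
  ⟨(minImages_nonempty δ).choose, (minImages_nonempty δ).choose_spec⟩

/-- `d(A) = d(T_A)`: the period of the naturally induced transducer over the digit alphabet
`{0,…,k-1}` (Müllner, Lemma 2.9 and the Remark after it: it only depends on `A`). For a base-`k`
automaton with the letters `≥ k` acting trivially this is Müllner's `d(A)`. [cite: Mullner2017, Lemma 2.9] -/
def transducerPeriod (k : ℕ) (δ : σ → ℕ → σ) : ℕ :=
  (transducerBase δ).period k

/-- Every state has period `d(A)`. [cite: Mullner2017, Lemma 2.9] -/
theorem MinImage.period_eq_transducerPeriod {k : ℕ} (hk : 0 < k) {δ : σ → ℕ → σ}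
    (htriv : ∀ q d, k ≤ d → δ q d = q) (M : MinImage δ) :
    M.period k = transducerPeriod k δ :=
  M.period_eq hk htriv _

/-- `d(A) > 0`. [folklore] -/
theorem transducerPeriod_pos {k : ℕ} (hk : 0 < k) {δ : σ → ℕ → σ}
    (htriv : ∀ q d, k ≤ d → δ q d = q) : 0 < transducerPeriod k δ :=
  (transducerBase δ).period_pos hk htriv

end Period

end Literature.NumberTheory.LFunctions
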